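import Literature.MathematicalPhysics.QuantumFieldTheory.Balaban1983to89.B15Prop1AxialGaugeSectionOfForest
import Literature.MathematicalPhysics.QuantumFieldTheory.Balaban1983to89.B15Prop1RealChartFamilyGaugeTransport
import Literature.MathematicalPhysics.QuantumFieldTheory.Balaban1983to89.B15Prop1DatumGaugeNormalisation
import Literature.MathematicalPhysics.QuantumFieldTheory.Balaban1983to89.B15Prop1DatumSmall7AtZSequence

/-!
# `Balaban1983to89.B15Prop1MinimiserTowerAxialGauge` — [Balaban1985RegularSpaces] = «[6]», (1.19) p. 79 (the axial gauge `Ax_k(𝔅_k, U₀)`);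
# [Balaban1985Variational] = «[15]», (4) p. 278 («u(y) = 1 for y ∈ 𝔅_k»), (16)–(18) p. 280; [Balaban1988Convergent] = «[III]», (2.2) p. 255, (2.10)–(2.13)
# pp. 256–257, (2.16) p. 257: THE TOWER-AXIAL GAUGE OF THE MINIMISER ITSELF — `σ(x) := 𝒰_{U₀}(path x)` along a rooted forest of record — its root
# letter, its tree bonds, its minimiser-hood, and the PINNED half of the localised near-flatness letter read off the normalised datum

statement-level skeleton of published theorems with citation tags; proofs where landed; nothing here is a claim about the Yang–Mills mass gap

WHY (cell `pub-ymgap`, HUMAN RULING D-0062 ∕ D-0149, width seat `pub-ymgap-dag-n12-w6` g1; node N12 = [B15]; piece (r3b-i) of the LOCATED-`hU` repair road of the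
N12∕s1 lane, 2026-08-28).  The near-flat letter package of the lane's endpoint asks for ONE configuration carrying both the chart family (K′) and the localised
near-flatness `hU`.  dag-n12-w5's `B15Prop1RealChartFamilyGaugeTransport` ∕ `…AtGauge` move the family from a minimiser `U₀` to `U₀^σ` for ANY fine-lattice gauge
transformation `σ` carrying the ROOT LETTER `hu` of `B15Prop1GaugeRetractionOfGaugeSection.agreeOn_gaugeAct_of_residual` (σ trivial at the block-tower sites of the
endpoints of the constrained bonds, all levels `≤ k` — [15] (4)); the knit is to supply `σ`.  Print's `σ` is the axial gauge `Ax_k(𝔅_k, U₀)` of [6] (1.19): along the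
rooted forest of the block towers (dag-n12-w6 g0's (F1)∕(F2) `path` datum of `B15Prop1AxialGaugeSectionOfForest`) put `σ(x) := 𝒰_{U₀}(path x)`, the parallel transport
of `U₀` from the root of `x` to `x`.  THIS FILE records what that `σ` does with NO estimate: (i) `hu` holds — roots have empty paths ((F2)); (ii) every forest bond of `U₀^σ`
is `1` — the telescoping of g0's `gaugeAct_pathGauge_apply_of_last` at `U = 1` ((F1)); (iii) `U₀^σ` is again a (2.12) minimiser of the SAME data (class invariance +
`agreeOn_gaugeAct_of_residual` + `A(U^σ) = A(U)`, dag-n12-w5's `isMinimizer_gaugeAct_of_agreeOn`); (iv) THE PINNED HALF of the localised `hU` at `U₀^σ`: on a bond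
meeting `Ω₁(Z)ᶜ` both endpoints are roots ((F2) at level `0`, [III] (2.2) `Γ₀ = Ω₁ᶜ`), so `U₀^σ(b) = U₀(b)` = the scale-`0` datum `(Q_k^{s*}Ṽ)(b)`, which is `1` or the
shadow value `Ṽ⟨B^k b₋, μ(b)⟩` — near `1` once the datum is normalised (`B15Prop1DatumGaugeNormalisation` §7∕§9).  The INTERIOR half (the bonds of
`inputs 𝔅 ∖ (forest ∪ Γ₀-bonds)`: Poincaré inside the towers + the corridor bonds through the constrained averages, [15] (16)–(18)) is NOT here.

CONTENTS (theorems only; no `def`, no `instance`, no `sorry`; `SU(2)` = the lane's group).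
* §1 ★ `gaugeAct_holAtGauge_apply_of_last` ((ii)), `holAtGauge_apply_eq_one_of_nil`, ★ `toMS_holAtGauge_eq_one` ((i) = the `hu` letter), `gaugeAct_holAtGauge_apply_of_roots`
  (`U₀^σ(b) = U₀(b)` when both endpoints have empty paths), `gaugeAct_holAtGauge_apply_of_not_mem` (so on every bond meeting `Ω₁(Z)ᶜ`, for the forest of `𝐁_k(Z)`).
* §2 ★★ `isMinimizer_gaugeAct_of_residual` (any averaging ∕ class invariant under `σ`), ★★ `isMinimizer_gaugeAct_holAtGauge_atRecord` ((iii) at NODE 00's class of record).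
* §3 ★★ `dist1_gaugeAct_holAtGauge_le_of_not_mem` ((iv): datum from a `k`-field `W`, shadow near `1` ⇒ `dist1 (U₀^σ b) ≤ δ`), `…_of_shadow` (set form).
* §4 ★★★ `exists_towerAxialGauge_atRecord` — at the endpoint's objects (`Node00.avOfRecord F 2 Kt`, `regMSCoPOfRecord F 2 ν Kt k (maxDomT ν.M₁ Z)`, `Bj ν.M₁ Z k`, datum
  `M˙(Q_k^{s*}W)`, `0 < k ≤ m + K`): for a rooted forest with (F1)(F2) and a minimiser `U₀`, ∃ `σ` with `hu σ` ∧ forest bonds of `U₀^σ` are `1` ∧ `U₀^σ` minimises the same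
  data ∧ `U₀^σ = U₀` on the bonds meeting `Ω₁(Z)ᶜ` ∧ `dist1 (U₀^σ b) ≤ δ` there whenever the shadow `⟨B^k b₋, μ(b)⟩` of a corridor bond lies in a set where `W` is `δ`-near `1`.
* §5 ★★ `dist1_iter_blockAvg_qsstarGIter0_le`, ★★ `dist1_avgFamily_avOfRecord_qsstarGIter0_le` — THE DATUM SIDE at every level: `(M˙(Q^{s*}_{j+n}Ṽ))_j(c) = (Q^{s*}_nṼ)(c)` is `1` or
  the shadow value `Ṽ⟨B^n c₋, μ(c)⟩` (`iter_blockAvg_qsstarGIter0_add` + `qsstarGIter_eq`), hence `δ`-near `1` when the shadow is.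
* §6 ★★★ `dist1_gaugeAct_holAtGauge_le_on_inputs` — THE JUNCTION on `inputs 𝐁_k(Z)` (dag-n12-w4's currency): pinned half (§3) + datum side + the DISPLAYED interior letter
  [15] (16)–(18) in the lane owner's shape ⟹ `dist1 (U₀^σ b) ≤ max δ₀ (A·ε + B·δ₁)` on every input bond.
* §6 (v1.1) ★★★ `dist1_gaugeAct_holAtGauge_le_on_inputs_of_flat` — the same junction with the interior letter in FLAT form `dist1 (U₀^σ b) ≤ Θ` on the input bonds of the levels `1 ≤ j ≤ k`
  (the shape the (q2) bricks `T4ForestGaugeSameRootBound` ∕ `T4ForestGaugeCorridorBound` produce: corridor bonds involve the data of a CHAIN of member bonds) ⟹ `≤ max δ₀ Θ` on `inputs 𝐁_k(Z)`.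

HONEST FRAMING: kernel group algebra and bookkeeping of [III] (2.2)∕(2.16); the forest (F1)(F2) and the minimiser are HYPOTHESES (dag-n12-w3's hierarchical comb; [15] Thm 1 ∕
the lane's (E)); no estimate of [15] (16)–(18) is asserted; count-neutral; N12 NOT discharged; finite 𝕋⁴ at fixed ε; nothing continuum ∕ OS ∕ mass-gap ∕ Clay.
-/

noncomputable section

open Set
open scoped Matrix.Norms.L2Operator

namespace Literature.MathematicalPhysics.QuantumFieldTheory.Balaban1983to89.B15Prop1MinimiserTowerAxialGauge

open T4Continuum B15DeterminingSets GaugeField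
open T4CubeChartGnomonic (SU2)
open B16Sect1Backgrounds (toMS)
open B14.Eq213DetSet (Bj maxDomT Bj_zero Bj_of_gt)
open B15Prop1AxialGaugeSectionOfForest (holAt_append_single)
open B15Prop1GaugeRetractionOfGaugeSection (agreeOn_gaugeAct_of_residual)
open B15Prop1RealChartFamilyGaugeTransport (isMinimizer_gaugeAct_of_agreeOn)
open B15Eq177ValueInvarianceCoDiv (gaugeAct_mem_regMSCoPOfRecord)
open B15Prop1DatumGaugeNormalisation (dist1_apply_le_of_isMinimizer_Bj_of_not_mem)
open Literature.MathematicalPhysics.QuantumFieldTheory.BalabanImbrieJaffe1984to88.BIJ85Eq453GaugeField (qsstarGIter0)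

variable {P : Params}

/-! ## §1  The tower-axial gauge `σ(x) = 𝒰_{U₀}(path x)`: tree bonds, roots, the root letter `hu` -/

section Gauge

/-- ★ **THE FOREST BONDS OF `U₀^σ` ARE `1`** for the tower-axial gauge `σ(x) := 𝒰_{U₀}(path x)`: if `s` is the last step of the path of `x″` after the path of `x′`, joining
them in the stated orientation ((F1)), then `(U₀^σ)(s.bond) = 1` — print's recursion `u(x″) = U₀(b)⁻¹u(x′)U(b)` solved along the tree ([6] (1.19): the axial gauge makes the tree
variables trivial). [cite: Balaban1985RegularSpaces, (1.19) p.79; Balaban1985Variational, (16)–(18) p.280; Balaban1985Averaging, (8) p.18] -/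
theorem gaugeAct_holAtGauge_apply_of_last (path : Site P 0 → List (LStep P 0)) (U₀ : GaugeField P 0 SU2) {x' x'' : Site P 0} {s : LStep P 0}
    (hp : path x'' = path x' ++ [s]) (hfwd : s.fwd = true → s.bond.src = x' ∧ s.bond.tgt = x'')
    (hbwd : s.fwd = false → s.bond.src = x'' ∧ s.bond.tgt = x') :
    gaugeAct (fun x => holAt U₀ (path x)) U₀ s.bond = 1 := by
  cases hs : s.fwd
  · obtain ⟨hsrc, htgt⟩ := hbwd hs
    show holAt U₀ (path s.bond.src) * U₀ s.bond * (holAt U₀ (path s.bond.tgt))⁻¹ = 1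
    rw [hsrc, htgt, hp, holAt_append_single, hs]
    simp only [Bool.false_eq_true, ↓reduceIte]
    group
  · obtain ⟨hsrc, htgt⟩ := hfwd hs
    show holAt U₀ (path s.bond.src) * U₀ s.bond * (holAt U₀ (path s.bond.tgt))⁻¹ = 1
    rw [hsrc, htgt, hp, holAt_append_single, hs]
    simp only [↓reduceIte]
    group

/-- With (F1) stated for every step of every path: `U₀^σ = 1` on every forest bond. [cite: Balaban1985RegularSpaces, (1.19) p.79] -/
theorem gaugeAct_holAtGauge_apply_eq_one_of_mem (path : Site P 0 → List (LStep P 0)) (U₀ : GaugeField P 0 SU2)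
    (hF1 : ∀ x, ∀ s ∈ path x, ∃ x' x'' : Site P 0, path x'' = path x' ++ [s] ∧
      (s.fwd = true → s.bond.src = x' ∧ s.bond.tgt = x'') ∧ (s.fwd = false → s.bond.src = x'' ∧ s.bond.tgt = x'))
    {x : Site P 0} {s : LStep P 0} (hs : s ∈ path x) :
    gaugeAct (fun x => holAt U₀ (path x)) U₀ s.bond = 1 := by
  obtain ⟨x', x'', hp, hfwd, hbwd⟩ := hF1 x s hs
  exact gaugeAct_holAtGauge_apply_of_last path U₀ hp hfwd hbwd

/-- At a ROOT (empty path) the gauge is trivial: `σ(x) = 𝒰_{U₀}(∅) = 1`. [cite: Balaban1985Variational, (4) p.278 («u(y) = 1 for y ∈ 𝔅_k»)] -/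
theorem holAtGauge_apply_eq_one_of_nil (path : Site P 0 → List (LStep P 0)) (U₀ : GaugeField P 0 SU2) {x : Site P 0} (hx : path x = []) :
    (fun x => holAt U₀ (path x)) x = 1 := by
  show holAt U₀ (path x) = 1
  rw [hx, holAt_nil]

/-- ★ **THE ROOT LETTER `hu` OF THE TOWER-AXIAL GAUGE** — [15] (4) *«u(y) = 1 for y ∈ 𝔅_k»*: by (F2) (the block-tower sites `embIter j y` of the endpoints of the bonds of `𝐁`,
levels `≤ k`, have empty paths) `σ` is trivial there, scale by scale — exactly the binder `hu` of `B15Prop1GaugeRetractionOfGaugeSection.agreeOn_gaugeAct_of_residual` ∕ of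
dag-n12-w5's `B15Prop1RealChartFamilyAtGauge.exists_realChartFamily_atGauge_atRecord`. [cite: Balaban1985Variational, (4) p.278; Balaban1988Convergent, (2.10) p.256] -/
theorem toMS_holAtGauge_eq_one (path : Site P 0 → List (LStep P 0)) (U₀ : GaugeField P 0 SU2) (𝔹 : DetSet P) (k : ℕ)
    (hF2 : ∀ j, j ≤ k → ∀ c ∈ bondsOf (𝔹 j), path (embIter j c.src) = [] ∧ path (embIter j c.tgt) = []) :
    ∀ j, j ≤ k → ∀ c ∈ bondsOf (𝔹 j),
      toMS (fun x => holAt U₀ (path x)) j c.src = 1 ∧ toMS (fun x => holAt U₀ (path x)) j c.tgt = 1 := by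
  intro j hj c hc
  obtain ⟨hs, ht⟩ := hF2 j hj c hc
  exact ⟨holAtGauge_apply_eq_one_of_nil path U₀ hs, holAtGauge_apply_eq_one_of_nil path U₀ ht⟩

/-- On a bond whose two endpoints are roots, the gauge does nothing: `U₀^σ(b) = U₀(b)`. [cite: Balaban1985Variational, (4) p.278; Balaban1985Averaging, (8) p.18] -/
theorem gaugeAct_holAtGauge_apply_of_roots (path : Site P 0 → List (LStep P 0)) (U₀ : GaugeField P 0 SU2) {b : PBond P 0}
    (hs : path b.src = []) (ht : path b.tgt = []) :
    gaugeAct (fun x => holAt U₀ (path x)) U₀ b = U₀ b := by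
  show holAt U₀ (path b.src) * U₀ b * (holAt U₀ (path b.tgt))⁻¹ = U₀ b
  rw [hs, ht, holAt_nil, one_mul, inv_one, mul_one]

/-- **ON THE BONDS MEETING `Ω₁(Z)ᶜ` THE TOWER-AXIAL GAUGE OF `𝐁_k(Z)` DOES NOTHING** (`0 < k`): their endpoints are endpoints of bonds of `𝐁_k(Z)`'s scale-`0` member
`Γ₀ = Ω₁(Z)ᶜ` ([III] (2.2), `Bj_zero`), hence roots by (F2) at `j = 0` (`embIter 0 = id`). [cite: Balaban1988Convergent, (2.2) p.255, (2.10) p.256; Balaban1985Variational, (4) p.278] -/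
theorem gaugeAct_holAtGauge_apply_of_not_mem (path : Site P 0 → List (LStep P 0)) (U₀ : GaugeField P 0 SU2) (M₁ : ℕ) (Z : Set (Site P 0))
    {k : ℕ} (hk0 : 0 < k)
    (hF2 : ∀ j, j ≤ k → ∀ c ∈ bondsOf (Bj M₁ Z k j), path (embIter j c.src) = [] ∧ path (embIter j c.tgt) = [])
    {b : PBond P 0} (hb : b.src ∉ maxDomT M₁ Z 1 ∨ b.tgt ∉ maxDomT M₁ Z 1) :
    gaugeAct (fun x => holAt U₀ (path x)) U₀ b = U₀ b := by
  have hmem : b ∈ bondsOf (Bj M₁ Z k 0) := by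
    rw [Bj_zero hk0]
    exact hb
  obtain ⟨hs, ht⟩ := hF2 0 (Nat.zero_le _) b hmem
  exact gaugeAct_holAtGauge_apply_of_roots path U₀ hs ht

end Gauge

/-! ## §2  `U₀^σ` is a (2.12) minimiser of the same data -/

section Minimiser

/-- ★★ **A RESIDUAL GAUGE KEEPS MINIMISER-HOOD** (any averaging family, any class invariant under `σ`, standing range): if `σ` carries the root letter `hu` at `𝔹`
(levels `≤ k`, `𝔹_j = ∅` above `k`), then `U₀^σ` realises the same multi-scale data as `U₀` (`agreeOn_gaugeAct_of_residual`) and, being in the class with the same action,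
is a (2.12) minimiser of the same problem whenever `U₀` is (dag-n12-w5's `isMinimizer_gaugeAct_of_agreeOn`). [cite: Balaban1988Convergent, (2.12) p.256; Balaban1985Variational, (4) p.278, (181) p.307] -/
theorem isMinimizer_gaugeAct_of_residual (av : ∀ j, Averaging P j SU2) {reg : Set (GaugeField P 0 SU2)} (𝔹 : DetSet P) {k : ℕ}
    (hk : k ≤ P.m + P.K) (h𝔹 : ∀ j, k < j → 𝔹 j = ∅) {σ : GaugeTransf P 0 SU2}
    (hu : ∀ j, j ≤ k → ∀ b ∈ bondsOf (𝔹 j), toMS σ j b.src = 1 ∧ toMS σ j b.tgt = 1)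
    (hreg : ∀ U, U ∈ reg → gaugeAct σ U ∈ reg) {V : MSField P SU2} {U₀ : GaugeField P 0 SU2} (hmin : IsMinimizer av reg 𝔹 V U₀) :
    IsMinimizer av reg 𝔹 V (gaugeAct σ U₀) :=
  isMinimizer_gaugeAct_of_agreeOn av σ (hreg U₀ hmin.1) (agreeOn_gaugeAct_of_residual av 𝔹 hk h𝔹 hu U₀) hmin

/-- ★★ **AT NODE 00's CLASS OF RECORD** (`regMSCoPOfRecord F 2 ν Kt k (maxDomT ν.M₁ Z)`, gauge invariant by `B15Eq177ValueInvarianceCoDiv.gaugeAct_mem_regMSCoPOfRecord`;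
`𝐁_k(Z)` lives at levels `≤ k`, `Bj_of_gt`): the tower-axial gauge of a rooted forest with (F2) carries a (2.12) minimiser `U₀` of `𝐁_k(Z)` to the minimiser `U₀^σ` of the
same data. [cite: Balaban1988Convergent, (2.12) p.256; Balaban1985Variational, (4) p.278] -/
theorem isMinimizer_gaugeAct_holAtGauge_atRecord {F : T4Family} (ν : Node00.Stage7Numerics) (Kt : ℕ) {k : ℕ} (hk : k ≤ (F.P Kt).m + (F.P Kt).K)
    (Z : Set (Site (F.P Kt) 0)) (path : Site (F.P Kt) 0 → List (LStep (F.P Kt) 0)) (U₀ : GaugeField (F.P Kt) 0 SU2)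
    (hF2 : ∀ j, j ≤ k → ∀ c ∈ bondsOf (Bj ν.M₁ Z k j), path (embIter j c.src) = [] ∧ path (embIter j c.tgt) = [])
    {V : MSField (F.P Kt) SU2}
    (hmin : IsMinimizer (Node00.avOfRecord F 2 Kt) (Node00.regMSCoPOfRecord F 2 ν Kt k (maxDomT ν.M₁ Z)) (Bj ν.M₁ Z k) V U₀) :
    IsMinimizer (Node00.avOfRecord F 2 Kt) (Node00.regMSCoPOfRecord F 2 ν Kt k (maxDomT ν.M₁ Z)) (Bj ν.M₁ Z k) V
      (gaugeAct (fun x => holAt U₀ (path x)) U₀) :=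
  isMinimizer_gaugeAct_of_residual (Node00.avOfRecord F 2 Kt) (Bj ν.M₁ Z k) hk (fun _ hj => Bj_of_gt hj)
    (toMS_holAtGauge_eq_one path U₀ (Bj ν.M₁ Z k) k hF2)
    (fun U hU => gaugeAct_mem_regMSCoPOfRecord ν Kt k (maxDomT ν.M₁ Z) _ U hU) hmin

end Minimiser

/-! ## §3  The pinned half of the localised near-flatness at `U₀^σ` -/

section Pinned

open B14.Eq22Determines (blockIter)

/-- ★★ **THE PINNED HALF OF `hU` AT THE GAUGED MINIMISER**: for the tower-axial gauge of a rooted forest of `𝐁_k(Z)` with (F2), a (2.12) minimiser `U₀` of the data generated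
by a `k`-field `W` (`M˙(Q_k^{s*}W)`), and a bond `b` meeting `Ω₁(Z)ᶜ`: `U₀^σ(b) = U₀(b)` is `1` or the shadow value `W⟨B^k b₋, μ(b)⟩`, so `dist1 (U₀^σ b) ≤ δ` as soon as the shadow is
`δ`-near `1` (`0 ≤ δ`; `B15Prop1DatumGaugeNormalisation.dist1_apply_le_of_isMinimizer_Bj_of_not_mem`).  With `W = Ṽ_k^{ũ}` normalised on a region box containing the shadows this is the
Γ₀-part of the lane's localised letter. [cite: Balaban1988Convergent, (2.2) p.255, (2.12)–(2.13) pp.256–257, (2.16) p.257] -/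
theorem dist1_gaugeAct_holAtGauge_le_of_not_mem (av : ∀ j, Averaging P j SU2) (reg : Set (GaugeField P 0 SU2)) (M₁ : ℕ) (Z : Set (Site P 0))
    {k : ℕ} (hk0 : 0 < k) (hk : k ≤ P.m + P.K) (path : Site P 0 → List (LStep P 0))
    (hF2 : ∀ j, j ≤ k → ∀ c ∈ bondsOf (Bj M₁ Z k j), path (embIter j c.src) = [] ∧ path (embIter j c.tgt) = [])
    (W : GaugeField P k SU2) {U₀ : GaugeField P 0 SU2} (hmin : IsMinimizer av reg (Bj M₁ Z k) (avgFamily av (qsstarGIter0 k W)) U₀)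
    {δ : ℝ} (hδ : 0 ≤ δ) {b : PBond P 0} (hb : b.src ∉ maxDomT M₁ Z 1 ∨ b.tgt ∉ maxDomT M₁ Z 1)
    (hW : B14.Eq22Determines.blockIter k b.tgt ≠ B14.Eq22Determines.blockIter k b.src →
      dist1 (W ⟨B14.Eq22Determines.blockIter k b.src, b.dir⟩) ≤ δ) :
    dist1 (gaugeAct (fun x => holAt U₀ (path x)) U₀ b) ≤ δ := by
  rw [gaugeAct_holAtGauge_apply_of_not_mem path U₀ M₁ Z hk0 hF2 hb]
  exact dist1_apply_le_of_isMinimizer_Bj_of_not_mem av reg M₁ Z hk0 hk W hmin hδ hb hW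

/-- The set form: shadows of the corridor bonds meeting `Ω₁(Z)ᶜ` inside a neighbourhood `𝒩` lie in a set `𝒞` where `W` is `δ`-near `1`. [cite: Balaban1988Convergent, (2.2) p.255, (2.16) p.257] -/
theorem dist1_gaugeAct_holAtGauge_le_of_shadow (av : ∀ j, Averaging P j SU2) (reg : Set (GaugeField P 0 SU2)) (M₁ : ℕ) (Z : Set (Site P 0))
    {k : ℕ} (hk0 : 0 < k) (hk : k ≤ P.m + P.K) (path : Site P 0 → List (LStep P 0))
    (hF2 : ∀ j, j ≤ k → ∀ c ∈ bondsOf (Bj M₁ Z k j), path (embIter j c.src) = [] ∧ path (embIter j c.tgt) = [])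
    (W : GaugeField P k SU2) {U₀ : GaugeField P 0 SU2} (hmin : IsMinimizer av reg (Bj M₁ Z k) (avgFamily av (qsstarGIter0 k W)) U₀)
    {δ : ℝ} (hδ : 0 ≤ δ) {𝒞 : Set (PBond P k)} (h𝒞 : ∀ c ∈ 𝒞, dist1 (W c) ≤ δ) {𝒩 : Set (PBond P 0)}
    (hshadow : ∀ b ∈ 𝒩, (b.src ∉ maxDomT M₁ Z 1 ∨ b.tgt ∉ maxDomT M₁ Z 1) →
      B14.Eq22Determines.blockIter k b.tgt ≠ B14.Eq22Determines.blockIter k b.src →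
      (⟨B14.Eq22Determines.blockIter k b.src, b.dir⟩ : PBond P k) ∈ 𝒞)
    {b : PBond P 0} (hb𝒩 : b ∈ 𝒩) (hb : b.src ∉ maxDomT M₁ Z 1 ∨ b.tgt ∉ maxDomT M₁ Z 1) :
    dist1 (gaugeAct (fun x => holAt U₀ (path x)) U₀ b) ≤ δ :=
  dist1_gaugeAct_holAtGauge_le_of_not_mem av reg M₁ Z hk0 hk path hF2 W hmin hδ hb fun h => h𝒞 _ (hshadow b hb𝒩 hb h)

end Pinned

/-! ## §4  At the endpoint's objects: the tower-axial gauge of a minimiser, all four clauses -/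

section Record

open B14.Eq22Determines (blockIter)

/-- ★★★ **THE TOWER-AXIAL GAUGE OF A (2.12) MINIMISER AT THE RECORD.**  Objects of the lane's endpoint: the averaging of record `Node00.avOfRecord F 2 Kt`, the class
`regMSCoPOfRecord F 2 ν Kt k (maxDomT ν.M₁ Z)`, the determining set `𝐁_k(Z) = Bj ν.M₁ Z k` (`0 < k ≤ m + K`), data `M˙(Q_k^{s*}W)` generated by a `k`-field `W` (e.g. the
normalised extended datum `Ṽ_k^{ũ}` of `B15Prop1DatumGaugeNormalisation.exists_gauge_normalising_extend_shellGauged`), a rooted forest `path` with the prefix∕orientation letter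
(F1) and the root letter (F2) at `𝐁_k(Z)` (dag-n12-w3's hierarchical comb), and a minimiser `U₀`.  Then the gauge transformation `σ(x) := 𝒰_{U₀}(path x)` satisfies:
(i) the ROOT LETTER `hu` (the binder of dag-n12-w5's `exists_realChartFamily_atGauge_atRecord`); (ii) `U₀^σ = 1` on every forest bond; (iii) `U₀^σ` is a minimiser of the SAME
data; (iv) `U₀^σ = U₀` on every bond meeting `Ω₁(Z)ᶜ`, and there `dist1 (U₀^σ b) ≤ δ` whenever the corridor shadow `⟨B^k b₋, μ(b)⟩` lies in a set `𝒞` on which `W` is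
`δ`-near `1` (`0 ≤ δ`).  The interior bonds of `inputs 𝐁_k(Z)` off the forest are NOT treated here ([15] (16)–(18)). [cite: Balaban1985RegularSpaces, (1.19) p.79;
Balaban1985Variational, (4) p.278, (16)–(18) p.280; Balaban1988Convergent, (2.2) p.255, (2.12) p.256, (2.16) p.257] -/
theorem exists_towerAxialGauge_atRecord {F : T4Family} (ν : Node00.Stage7Numerics) (Kt : ℕ) {k : ℕ} (hk0 : 0 < k)
    (hk : k ≤ (F.P Kt).m + (F.P Kt).K) (Z : Set (Site (F.P Kt) 0))
    (path : Site (F.P Kt) 0 → List (LStep (F.P Kt) 0))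
    (hF1 : ∀ x, ∀ s ∈ path x, ∃ x' x'' : Site (F.P Kt) 0, path x'' = path x' ++ [s] ∧
      (s.fwd = true → s.bond.src = x' ∧ s.bond.tgt = x'') ∧ (s.fwd = false → s.bond.src = x'' ∧ s.bond.tgt = x'))
    (hF2 : ∀ j, j ≤ k → ∀ c ∈ bondsOf (Bj ν.M₁ Z k j), path (embIter j c.src) = [] ∧ path (embIter j c.tgt) = [])
    (W : GaugeField (F.P Kt) k SU2) {U₀ : GaugeField (F.P Kt) 0 SU2}
    (hmin : IsMinimizer (Node00.avOfRecord F 2 Kt) (Node00.regMSCoPOfRecord F 2 ν Kt k (maxDomT ν.M₁ Z)) (Bj ν.M₁ Z k)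
      (avgFamily (Node00.avOfRecord F 2 Kt) (qsstarGIter0 k W)) U₀)
    {δ : ℝ} (hδ : 0 ≤ δ) {𝒞 : Set (PBond (F.P Kt) k)} (h𝒞 : ∀ c ∈ 𝒞, dist1 (W c) ≤ δ) :
    ∃ σ : GaugeTransf (F.P Kt) 0 SU2,
      (∀ j, j ≤ k → ∀ c ∈ bondsOf (Bj ν.M₁ Z k j), toMS σ j c.src = 1 ∧ toMS σ j c.tgt = 1) ∧
      (∀ x, ∀ s ∈ path x, gaugeAct σ U₀ s.bond = 1) ∧
      IsMinimizer (Node00.avOfRecord F 2 Kt) (Node00.regMSCoPOfRecord F 2 ν Kt k (maxDomT ν.M₁ Z)) (Bj ν.M₁ Z k)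
        (avgFamily (Node00.avOfRecord F 2 Kt) (qsstarGIter0 k W)) (gaugeAct σ U₀) ∧
      (∀ b : PBond (F.P Kt) 0, (b.src ∉ maxDomT ν.M₁ Z 1 ∨ b.tgt ∉ maxDomT ν.M₁ Z 1) → gaugeAct σ U₀ b = U₀ b) ∧
      ∀ b : PBond (F.P Kt) 0, (b.src ∉ maxDomT ν.M₁ Z 1 ∨ b.tgt ∉ maxDomT ν.M₁ Z 1) →
        (B14.Eq22Determines.blockIter k b.tgt ≠ B14.Eq22Determines.blockIter k b.src →
          (⟨B14.Eq22Determines.blockIter k b.src, b.dir⟩ : PBond (F.P Kt) k) ∈ 𝒞) →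
        dist1 (gaugeAct σ U₀ b) ≤ δ :=
  ⟨fun x => holAt U₀ (path x), toMS_holAtGauge_eq_one path U₀ (Bj ν.M₁ Z k) k hF2,
    fun _ _ hs => gaugeAct_holAtGauge_apply_eq_one_of_mem path U₀ hF1 hs,
    isMinimizer_gaugeAct_holAtGauge_atRecord ν Kt hk Z path U₀ hF2 hmin,
    fun _ hb => gaugeAct_holAtGauge_apply_of_not_mem path U₀ ν.M₁ Z hk0 hF2 hb,
    fun _ hb hsh => dist1_gaugeAct_holAtGauge_le_of_not_mem (Node00.avOfRecord F 2 Kt) _ ν.M₁ Z hk0 hk path hF2 W hmin hδ hb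
      fun h => h𝒞 _ (hsh h)⟩

/-- The same with the lane's matrix-norm reading of `dist1` on `SU(2)` (`B15Prop1DatumGaugeNormalisation.dist1_eq_norm_sub_one_su2`): `‖↑(U₀^σ b) − 1‖ ≤ δ`.
[cite: Balaban1985Averaging, (19) p.21; Balaban1988Convergent, (2.2) p.255] -/
theorem norm_gaugeAct_holAtGauge_sub_one_le_of_not_mem {F : T4Family} (ν : Node00.Stage7Numerics) (Kt : ℕ) {k : ℕ} (hk0 : 0 < k)
    (hk : k ≤ (F.P Kt).m + (F.P Kt).K) (Z : Set (Site (F.P Kt) 0)) (path : Site (F.P Kt) 0 → List (LStep (F.P Kt) 0))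
    (hF2 : ∀ j, j ≤ k → ∀ c ∈ bondsOf (Bj ν.M₁ Z k j), path (embIter j c.src) = [] ∧ path (embIter j c.tgt) = [])
    (W : GaugeField (F.P Kt) k SU2) {U₀ : GaugeField (F.P Kt) 0 SU2}
    (hmin : IsMinimizer (Node00.avOfRecord F 2 Kt) (Node00.regMSCoPOfRecord F 2 ν Kt k (maxDomT ν.M₁ Z)) (Bj ν.M₁ Z k)
      (avgFamily (Node00.avOfRecord F 2 Kt) (qsstarGIter0 k W)) U₀)
    {δ : ℝ} (hδ : 0 ≤ δ) {b : PBond (F.P Kt) 0} (hb : b.src ∉ maxDomT ν.M₁ Z 1 ∨ b.tgt ∉ maxDomT ν.M₁ Z 1)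
    (hW : B14.Eq22Determines.blockIter k b.tgt ≠ B14.Eq22Determines.blockIter k b.src →
      ‖((W ⟨B14.Eq22Determines.blockIter k b.src, b.dir⟩ : SU2) : Matrix (Fin 2) (Fin 2) ℂ) - 1‖ ≤ δ) :
    ‖((gaugeAct (fun x => holAt U₀ (path x)) U₀ b : SU2) : Matrix (Fin 2) (Fin 2) ℂ) - 1‖ ≤ δ :=
  dist1_gaugeAct_holAtGauge_le_of_not_mem (Node00.avOfRecord F 2 Kt) _ ν.M₁ Z hk0 hk path hF2 W hmin hδ hb hW

end Record

/-! ## §5  The multi-scale datum `M˙(Q_k^{s*}Ṽ)` at every level reads `Ṽ` on shadow bonds (the datum side of the interior letter) -/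

section Datum

variable {G : Type*} [GaugeGroup G]

open BlockAveraging (blockAvg)
open B15Prop1DatumSmall7AtZSequence (iter_blockAvg_qsstarGIter0_add)
open B7SectAStatements (blockOfIter)
open Literature.MathematicalPhysics.QuantumFieldTheory.BalabanImbrieJaffe1984to88.BIJ85Eq453GaugeField (qsstarGIter qsstarGIter_eq)

/-- ★★ **THE LEVEL-`j` DATUM IS `1` OR A SHADOW VALUE OF `Ṽ`**: for Bałaban's (0.4) block averaging `blockAvg ℰ` with `ℰ(1,…,1) = 1` (the printed exp[mean log]:
`T3DescentFibreTower.expMeanLogSU_E_one`), the scale-`j` entry of the datum `M˙(Q^{s*}_{j+n}Ṽ)` at a `j`-bond `c` is `(Q^{s*}_nṼ)(c)` (`iter_blockAvg_qsstarGIter0_add`: [III] p. 267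
«M^{k+1}(U_{k+1}) = V_{k+1} … by the constraints») — `1` inside an `n`-block, `Ṽ⟨B^n c₋, μ(c)⟩` on a corridor bond (`qsstarGIter_eq`); hence `dist1 ≤ δ` as soon as the shadow is `δ`-near `1`
(`0 ≤ δ`).  The datum side of the interior near-flatness letter [15] (16)–(18) after the normalisation of `B15Prop1DatumGaugeNormalisation`. [cite: Balaban1988Convergent, (2.16) p.257, p.267 L5–7; Balaban1985Variational, (16)–(18) p.280] -/
theorem dist1_iter_blockAvg_qsstarGIter0_le (ℰ : LoopAverage G) (hE : ∀ n : ℕ, ℰ.E (fun _ : Fin (n + 1) => (1 : G)) = 1)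
    {j n : ℕ} (hjn : j + n ≤ P.m + P.K) (V : GaugeField P (j + n) G) {δ : ℝ} (hδ : 0 ≤ δ) (c : PBond P j)
    (hV : blockOfIter n c.tgt ≠ blockOfIter n c.src → dist1 (V ⟨blockOfIter n c.src, c.dir⟩) ≤ δ) :
    dist1 (Averaging.iter (fun i => blockAvg (P := P) (j := i) ℰ) j (qsstarGIter0 (j + n) V) c) ≤ δ := by
  rw [iter_blockAvg_qsstarGIter0_add ℰ hE (by omega) V, qsstarGIter_eq n hjn V c]
  split_ifs with h
  · rw [GaugeGroup.dist1_one]; exact hδ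
  · exact hV h

/-- ★★ **AT THE AVERAGING OF RECORD** (`Node00.avOfRecord F N Kt = blockAvg expMeanLogSU`, `rfl`): the level-`j` entry of the endpoint's datum `M˙(Q_k^{s*}Ṽ)` (`k = j + n`) at a
`j`-bond `c` satisfies `dist1 ≤ δ` whenever the corridor shadow `⟨B^n c₋, μ(c)⟩` of `c` has `dist1 (Ṽ ·) ≤ δ`. [cite: Balaban1988Convergent, (2.16) p.257, p.267 L5–7; Balaban1987RG1, (0.4) p.253] -/
theorem dist1_avgFamily_avOfRecord_qsstarGIter0_le {F : T4Family} {N : ℕ} [NeZero N] (Kt : ℕ) {j n : ℕ}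
    (hjn : j + n ≤ (F.P Kt).m + (F.P Kt).K) (V : GaugeField (F.P Kt) (j + n) (Node00.SU N)) {δ : ℝ} (hδ : 0 ≤ δ) (c : PBond (F.P Kt) j)
    (hV : blockOfIter n c.tgt ≠ blockOfIter n c.src → dist1 (V ⟨blockOfIter n c.src, c.dir⟩) ≤ δ) :
    dist1 (avgFamily (Node00.avOfRecord F N Kt) (qsstarGIter0 (j + n) V) j c) ≤ δ :=
  dist1_iter_blockAvg_qsstarGIter0_le _ T3DescentFibreTower.expMeanLogSU_E_one hjn V hδ c hV

end Datum

/-! ## §6  The junction: pinned half + datum side + the DISPLAYED interior letter [15] (16)–(18) ⟹ near-flatness of `U₀^σ` on `inputs 𝐁_k(Z)` -/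

section Junction

open B14.Eq216Concrete (inputs mem_inputs feeds feeds_zero)

/-- ★★★ **THE LOCALISED NEAR-FLATNESS OF `U₀^σ` ON `inputs 𝐁_k(Z)` MODULO THE INTERIOR LETTER** (the lane's `hUloc` in dag-n12-w4's `inputs` currency).  Hypotheses: the
tower-axial gauge data of §4 (forest (F2) at `𝐁_k(Z)`, minimiser `U₀` of the data `M˙(Q_k^{s*}Ṽ)`, `0 < k ≤ m + K`); the PINNED side: `Ṽ` is `δ₀`-near `1` at the scale-`k` corridor
shadows of the bonds of `Γ₀ = Ω₁(Z)ᶜ`; the DATUM side at every level `1 ≤ j ≤ k`: `dist1 ((M˙(Q_k^{s*}Ṽ)) j c) ≤ δ₁` on the bonds of `𝐁_k(Z)_j` (§5 discharges it from `Ṽ`'s shadows);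
and the DISPLAYED INTERIOR LETTER `hL` — [15] (16)–(18) p. 280 ∕ [6] (1.19) in the shape worded by the lane owner: *in the gauge `Ax_k(𝔅_k, U₀)`, for every `j ≥ 1`, every constrained
bond `c` of level `j` and every fine bond `b` feeding its average, `|U₀^σ(b) − 1| ≤ A·ε + B·|(M˙(Q_k^{s*}Ṽ))_j(c) − 1|`* (`0 ≤ B`).  Conclusion: `dist1 (U₀^σ b) ≤ max δ₀ (A·ε + B·δ₁)` on
EVERY bond of `inputs 𝐁_k(Z)`. [cite: Balaban1985Variational, (4) p.278, (16)–(18) p.280; Balaban1985RegularSpaces, (1.19) p.79; Balaban1988Convergent, (2.2) p.255, (2.11) p.256, (2.16) p.257] -/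
theorem dist1_gaugeAct_holAtGauge_le_on_inputs (av : ∀ j, Averaging P j SU2) (reg : Set (GaugeField P 0 SU2)) (M₁ : ℕ) (Z : Set (Site P 0))
    {k : ℕ} (hk0 : 0 < k) (hk : k ≤ P.m + P.K) (path : Site P 0 → List (LStep P 0))
    (hF2 : ∀ j, j ≤ k → ∀ c ∈ bondsOf (Bj M₁ Z k j), path (embIter j c.src) = [] ∧ path (embIter j c.tgt) = [])
    (W : GaugeField P k SU2) {U₀ : GaugeField P 0 SU2} (hmin : IsMinimizer av reg (Bj M₁ Z k) (avgFamily av (qsstarGIter0 k W)) U₀)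
    {δ₀ δ₁ A B ε : ℝ} (hδ₀ : 0 ≤ δ₀) (hB : 0 ≤ B)
    -- PINNED side: the scale-`k` shadows of the corridor bonds of `Γ₀` are `δ₀`-near `1`
    (hW0 : ∀ b ∈ bondsOf (Bj M₁ Z k 0), B14.Eq22Determines.blockIter k b.tgt ≠ B14.Eq22Determines.blockIter k b.src →
      dist1 (W ⟨B14.Eq22Determines.blockIter k b.src, b.dir⟩) ≤ δ₀)
    -- DATUM side at the levels `1 ≤ j ≤ k`
    (hWj : ∀ j, 1 ≤ j → j ≤ k → ∀ c ∈ bondsOf (Bj M₁ Z k j), dist1 (avgFamily av (qsstarGIter0 k W) j c) ≤ δ₁)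
    -- DISPLAYED: the interior estimate [15] (16)–(18) in the tower-axial gauge
    (hL : ∀ j, 1 ≤ j → j ≤ k → ∀ c ∈ bondsOf (Bj M₁ Z k j), ∀ b ∈ feeds j c,
      dist1 (gaugeAct (fun x => holAt U₀ (path x)) U₀ b) ≤ A * ε + B * dist1 (avgFamily av (qsstarGIter0 k W) j c))
    {b : PBond P 0} (hb : b ∈ inputs (Bj M₁ Z k)) :
    dist1 (gaugeAct (fun x => holAt U₀ (path x)) U₀ b) ≤ max δ₀ (A * ε + B * δ₁) := by
  obtain ⟨j, c, hc, hbc⟩ := mem_inputs.1 hb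
  by_cases hjk : j ≤ k
  · rcases Nat.eq_zero_or_pos j with hj0 | hjpos
    · -- level `0`: `b = c` is a bond of `Γ₀ = Ω₁(Z)ᶜ`, pinned to the datum
      subst hj0
      rw [feeds_zero, Set.mem_singleton_iff] at hbc
      subst hbc
      have hb' : b.src ∉ maxDomT M₁ Z 1 ∨ b.tgt ∉ maxDomT M₁ Z 1 := by
        have h := hc
        rw [Bj_zero hk0] at h
        exact h
      exact (dist1_gaugeAct_holAtGauge_le_of_not_mem av reg M₁ Z hk0 hk path hF2 W hmin hδ₀ hb' (hW0 b hc)).trans (le_max_left _ _)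
    · -- level `j ≥ 1`: the interior letter and the datum side
      have h1 := hL j hjpos hjk c hc b hbc
      have h2 := hWj j hjpos hjk c hc
      calc dist1 (gaugeAct (fun x => holAt U₀ (path x)) U₀ b) ≤ A * ε + B * dist1 (avgFamily av (qsstarGIter0 k W) j c) := h1
        _ ≤ A * ε + B * δ₁ := by nlinarith
        _ ≤ max δ₀ (A * ε + B * δ₁) := le_max_right _ _
  · -- above the range `𝐁_k(Z)_j = ∅`
    rw [Bj_of_gt (Nat.lt_of_not_le hjk)] at hc
    simp [bondsOf] at hc

/-- ★★★ **(v1.1) THE SAME WITH THE INTERIOR LETTER IN FLAT FORM** — the shape the (q2) bricks actually produce: the same-root bonds (`T4ForestGaugeSameRootBound`) are within a Stokes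
bound of `1`, the corridor bonds (`T4ForestGaugeCorridorBound`, master bound + chains) within `Stokes + Σθ + Σ_{links} dist1 (datum)` — a bound involving the data of SEVERAL member bonds (the
chain), not only of the `c` whose average `b` feeds; so the knit supplies ONE flat bound `Θ` on the input bonds of the levels `1 ≤ j ≤ k` (after bounding every member datum by `δ₁`, §5) and
this edition concludes `dist1 (U₀^σ b) ≤ max δ₀ Θ` on every bond of `inputs 𝐁_k(Z)` (pinned half for `Γ₀` exactly as above). [cite: Balaban1985Variational, (4) p.278, (16)–(18) p.280; Balaban1985RegularSpaces, (1.19) p.79; Balaban1988Convergent, (2.2) p.255, (2.11) p.256] -/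
theorem dist1_gaugeAct_holAtGauge_le_on_inputs_of_flat (av : ∀ j, Averaging P j SU2) (reg : Set (GaugeField P 0 SU2)) (M₁ : ℕ) (Z : Set (Site P 0))
    {k : ℕ} (hk0 : 0 < k) (hk : k ≤ P.m + P.K) (path : Site P 0 → List (LStep P 0))
    (hF2 : ∀ j, j ≤ k → ∀ c ∈ bondsOf (Bj M₁ Z k j), path (embIter j c.src) = [] ∧ path (embIter j c.tgt) = [])
    (W : GaugeField P k SU2) {U₀ : GaugeField P 0 SU2} (hmin : IsMinimizer av reg (Bj M₁ Z k) (avgFamily av (qsstarGIter0 k W)) U₀)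
    {δ₀ Θ : ℝ} (hδ₀ : 0 ≤ δ₀)
    -- PINNED side: the scale-`k` shadows of the corridor bonds of `Γ₀` are `δ₀`-near `1`
    (hW0 : ∀ b ∈ bondsOf (Bj M₁ Z k 0), B14.Eq22Determines.blockIter k b.tgt ≠ B14.Eq22Determines.blockIter k b.src →
      dist1 (W ⟨B14.Eq22Determines.blockIter k b.src, b.dir⟩) ≤ δ₀)
    -- the interior letter in FLAT form at the levels `1 ≤ j ≤ k`
    (hL : ∀ j, 1 ≤ j → j ≤ k → ∀ c ∈ bondsOf (Bj M₁ Z k j), ∀ b ∈ feeds j c, dist1 (gaugeAct (fun x => holAt U₀ (path x)) U₀ b) ≤ Θ)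
    {b : PBond P 0} (hb : b ∈ inputs (Bj M₁ Z k)) :
    dist1 (gaugeAct (fun x => holAt U₀ (path x)) U₀ b) ≤ max δ₀ Θ := by
  obtain ⟨j, c, hc, hbc⟩ := mem_inputs.1 hb
  by_cases hjk : j ≤ k
  · rcases Nat.eq_zero_or_pos j with hj0 | hjpos
    · subst hj0
      rw [feeds_zero, Set.mem_singleton_iff] at hbc
      subst hbc
      have hb' : b.src ∉ maxDomT M₁ Z 1 ∨ b.tgt ∉ maxDomT M₁ Z 1 := by
        have h := hc
        rw [Bj_zero hk0] at h
        exact h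
      exact (dist1_gaugeAct_holAtGauge_le_of_not_mem av reg M₁ Z hk0 hk path hF2 W hmin hδ₀ hb' (hW0 b hc)).trans (le_max_left _ _)
    · exact (hL j hjpos hjk c hc b hbc).trans (le_max_right _ _)
  · rw [Bj_of_gt (Nat.lt_of_not_le hjk)] at hc
    simp [bondsOf] at hc

end Junction

end Literature.MathematicalPhysics.QuantumFieldTheory.Balaban1983to89.B15Prop1MinimiserTowerAxialGauge

end
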